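import Literature.NumberTheory.EllipticCurves.EisensteinSeriesNebentypus
import HarnessLib

/-!
# Eisenstein series with two characters: `E_k^{ψ,φ}` on `Γ₀(uv)`, its nebentypus law and its
# constant terms at all cusps

Topic `Literature/NumberTheory/EllipticCurves`; namespace
`Literature.NumberTheory.EllipticCurves.ModularForms`.  THEOREMS ONLY (definitions with bodies; no
named fact).

For Dirichlet characters `ψ` modulo `u` and `φ` modulo `v` (values in `ℂ`) and a weight `k ≥ 3`
we define the Eisenstein series of Diamond–Shurman §4.5–4.6 in the "coprime pairs" normalisation
(constant term a root of unity),

  `E_k^{ψ,φ}(τ) = ∑_{c₁ mod u} ∑_{d₀ mod uv} ψ(c₁) φ̄(d₀) E_{k,(v c₁, d₀)}(τ)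
              = ∑_{gcd(c,d)=1, v ∣ c} ψ(c/v) φ̄(d) (cτ + d)^{-k}`

(`eisensteinTwoChar`; `E_{k,a}` is Mathlib's level-`Γ(uv)` series `eisensteinSeries a k`), prove
the nebentypus law `E_k^{ψ,φ} ∣_k γ = ψ(d) φ(d) E_k^{ψ,φ}` for `γ = (a b; c d) ∈ Γ₀(uv)`
(`eisensteinTwoChar_slash_of_mem_gamma0`), package it as a modular form on `Γ₁(uv)`
(`eisensteinTwoCharMF`), and compute its constant term at EVERY cusp: for `γ = (a b; c d) ∈ SL₂(ℤ)`,
`E_k^{ψ,φ} ∣_k γ → 0` at `i∞` unless `v ∣ c`, and if `c = v c'` then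
`E_k^{ψ,φ} ∣_k γ → ψ(-c') φ̄(a) (1 + (-1)^{-k} ψ(-1) φ(-1))`
(`tendsto_eisensteinTwoChar_slash_atImInfty_of_not_dvd`, `…_of_eq_mul`): the constant terms are
supported on the cusps `a/c` with `v ∣ c`, `gcd(c/v, u) = 1`, where they are roots of unity (times
`2`).  This is the input "constant terms of the auxiliary Eisenstein series vanish at all cusps not
above `1/v`" of the Eisenstein-ideal / level-raising arguments (Wiles, Invent. Math. 94 (1988),
Prop. 1.?; Diamond–Shurman §4.5–4.6 for the series themselves).

## References

* F. Diamond, J. Shurman, *A First Course in Modular Forms*, GTM 228 (2005), §4.2 (Thm. 4.2.3),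
  §4.5 (Thm. 4.5.1), §4.6 (Thm. 4.6.2). [DiamondShurman2005]
-/

noncomputable section

open ModularForm EisensteinSeries UpperHalfPlane CongruenceSubgroup Filter Matrix
  Matrix.SpecialLinearGroup
open scoped MatrixGroups Topology Manifold

namespace Literature.NumberTheory.EllipticCurves.ModularForms

section TwoChar

variable {u v : ℕ} [NeZero u] [NeZero v] {k : ℤ} (ψ : DirichletCharacter ℂ u)
  (φ : DirichletCharacter ℂ v)

/-- `NeZero (u v)`. [folklore] -/
instance neZero_mul_level : NeZero (u * v) := ⟨mul_ne_zero (NeZero.ne u) (NeZero.ne v)⟩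

/-- The element `v · c₁ ∈ ℤ/uv` attached to `c₁ ∈ ℤ/u` (well defined). [folklore] -/
def vMul (c₁ : ZMod u) : ZMod (u * v) := ((v * c₁.val : ℕ) : ZMod (u * v))

omit [NeZero v] in
/-- `v · m ≡ v · m' (mod uv)` when `m ≡ m' (mod u)`: `vMul` computed from any integer lift.
[folklore] -/
theorem vMul_intCast (m : ℤ) :
    vMul (v := v) ((m : ZMod u)) = (((v : ℤ) * m : ℤ) : ZMod (u * v)) := by
  unfold vMul
  rw [← Int.cast_natCast, ZMod.intCast_eq_intCast_iff_dvd_sub]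
  have h : (u : ℤ) ∣ m - ((m : ZMod u).val : ℤ) :=
    (ZMod.intCast_eq_intCast_iff_dvd_sub _ _ u).mp (by rw [Int.cast_natCast, ZMod.natCast_zmod_val])
  obtain ⟨t, ht⟩ := h
  refine ⟨t, ?_⟩
  push_cast
  linear_combination (v : ℤ) * ht

/-- The index vector `(v c₁, d₀) ∈ (ℤ/uv)²`. [folklore] -/
def tcVec (c₁ : ZMod u) (d₀ : ZMod (u * v)) : Fin 2 → ZMod (u * v) := ![vMul c₁, d₀]

/-- The weight `ψ(c₁) φ̄(d₀ mod v)`. [folklore] -/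
def tcWeight (c₁ : ZMod u) (d₀ : ZMod (u * v)) : ℂ :=
  ψ c₁ * φ⁻¹ (ZMod.castHom (dvd_mul_left v u) (ZMod v) d₀)

variable (k) in
/-- **The Eisenstein series `E_k^{ψ,φ}` with two characters** (`ψ` modulo `u` on the lower-left
entry, `φ̄` modulo `v` on the lower-right entry), in the coprime-pairs normalisation:
`E_k^{ψ,φ} = ∑_{c₁ mod u} ∑_{d₀ mod uv} ψ(c₁) φ̄(d₀) E_{k,(vc₁,d₀)}`.
[cite: DiamondShurman2005, §4.5–4.6] -/
def eisensteinTwoChar : ℍ → ℂ := fun z ↦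
  ∑ c₁ : ZMod u, ∑ d₀ : ZMod (u * v), tcWeight ψ φ c₁ d₀ * eisensteinSeries (tcVec c₁ d₀) k z

/-- `E_k^{ψ,φ}` as a sum of functions. [folklore] -/
theorem eisensteinTwoChar_eq_sum : eisensteinTwoChar k ψ φ =
    ∑ c₁ : ZMod u, ∑ d₀ : ZMod (u * v), tcWeight ψ φ c₁ d₀ • eisensteinSeries (tcVec c₁ d₀) k := by
  funext z
  simp [eisensteinTwoChar, Finset.sum_apply]

omit [NeZero v] in
/-- `vMul` of a product with an integer: `v (c₁ m) = (v c₁) m`. [folklore] -/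
theorem vMul_mul_intCast (c₁ : ZMod u) (m : ℤ) :
    vMul (v := v) (c₁ * (m : ZMod u)) = vMul c₁ * (m : ZMod (u * v)) := by
  have hc : c₁ = ((c₁.val : ℤ) : ZMod u) := by rw [Int.cast_natCast, ZMod.natCast_zmod_val]
  rw [hc, ← Int.cast_mul, vMul_intCast, vMul_intCast]
  push_cast
  ring

omit [NeZero u] [NeZero v] in
/-- `vMul c₁` reduces to `0` modulo `v`. [folklore] -/
theorem castHom_vMul (c₁ : ZMod u) : ZMod.castHom (dvd_mul_left v u) (ZMod v) (vMul c₁) = 0 := by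
  unfold vMul
  rw [map_natCast, Nat.cast_mul, ZMod.natCast_self, zero_mul]

/-- `vMul` is injective. [folklore] -/
theorem vMul_injective : Function.Injective (vMul (u := u) (v := v)) := by
  intro c c' h
  unfold vMul at h
  have hv : 0 < v := Nat.pos_of_ne_zero (NeZero.ne v)
  have hlt : ∀ x : ZMod u, v * x.val < u * v := fun x ↦ by
    rw [mul_comm u v]; exact Nat.mul_lt_mul_of_pos_left (ZMod.val_lt x) hv
  rw [ZMod.natCast_eq_natCast_iff', Nat.mod_eq_of_lt (hlt c), Nat.mod_eq_of_lt (hlt c')] at h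
  exact ZMod.val_injective u (Nat.eq_of_mul_eq_mul_left hv h)

omit [NeZero v] in
/-- **`(v c₁, d₀) γ = (v (c₁ a), d₀ d + (v c₁) b)` for `γ = (a b; c d) ∈ Γ₀(uv)`.** [folklore] -/
theorem tcVec_vecMul_of_mem_gamma0 {γ : SL(2, ℤ)} (hγ : γ ∈ Gamma0 (u * v)) (c₁ : ZMod u)
    (d₀ : ZMod (u * v)) :
    (tcVec c₁ d₀ : Fin 2 → ZMod (u * v)) ᵥ* γ =
      tcVec (c₁ * ((γ 0 0 : ℤ) : ZMod u))
        (d₀ * ((γ 1 1 : ℤ) : ZMod (u * v)) + vMul c₁ * ((γ 0 1 : ℤ) : ZMod (u * v))) := by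
  rw [Gamma0_mem] at hγ
  funext j
  fin_cases j
  · simp [tcVec, Matrix.vecMul, dotProduct, Fin.sum_univ_two, hγ, vMul_mul_intCast]
  · simp [tcVec, Matrix.vecMul, dotProduct, Fin.sum_univ_two]
    ring

omit [NeZero u] [NeZero v] in
/-- For `γ = (a b; c d) ∈ Γ₀(uv)`: `a d ≡ 1 (mod uv)`. [folklore] -/
theorem apply_zero_zero_mul_apply_one_one_of_mem_gamma0 {γ : SL(2, ℤ)} (hγ : γ ∈ Gamma0 (u * v)) :
    ((γ 0 0 : ℤ) : ZMod (u * v)) * ((γ 1 1 : ℤ) : ZMod (u * v)) = 1 := by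
  have hdet := Matrix.SpecialLinearGroup.det_coe γ
  rw [Matrix.det_fin_two] at hdet
  have := congrArg ((↑) : ℤ → ZMod (u * v)) hdet
  push_cast at this
  rwa [Gamma0_mem.mp hγ, mul_zero, sub_zero] at this

/-- **The nebentypus law**: `E_k^{ψ,φ} ∣_k γ = ψ(d) φ(d) E_k^{ψ,φ}` for `γ = (a b; c d) ∈ Γ₀(uv)`
(reindex `(c₁, d₀) ↦ (c₁ a, d₀ d + v c₁ b)`). [cite: DiamondShurman2005, §4.5–4.6 (Thm. 4.5.1, Thm. 4.6.2)] -/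
theorem eisensteinTwoChar_slash_of_mem_gamma0 {γ : SL(2, ℤ)} (hγ : γ ∈ Gamma0 (u * v)) :
    eisensteinTwoChar k ψ φ ∣[k] γ =
      (ψ ((γ 1 1 : ℤ) : ZMod u) * φ ((γ 1 1 : ℤ) : ZMod v)) • eisensteinTwoChar k ψ φ := by
  have had_uv := apply_zero_zero_mul_apply_one_one_of_mem_gamma0 hγ
  have had_u : ((γ 0 0 : ℤ) : ZMod u) * ((γ 1 1 : ℤ) : ZMod u) = 1 := by
    have := congrArg (ZMod.castHom (dvd_mul_right u v) (ZMod u)) had_uv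
    rwa [map_mul, map_intCast, map_intCast, map_one] at this
  have had_v : ((γ 0 0 : ℤ) : ZMod v) * ((γ 1 1 : ℤ) : ZMod v) = 1 := by
    have := congrArg (ZMod.castHom (dvd_mul_left v u) (ZMod v)) had_uv
    rwa [map_mul, map_intCast, map_intCast, map_one] at this
  obtain ⟨dU, hdU⟩ : ∃ dU : (ZMod (u * v))ˣ, (dU : ZMod (u * v)) = ((γ 1 1 : ℤ) : ZMod (u * v)) :=
    ⟨Units.mkOfMulEqOne (((γ 1 1 : ℤ) : ZMod (u * v))) (((γ 0 0 : ℤ) : ZMod (u * v)))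
      ((mul_comm _ _).trans had_uv), rfl⟩
  obtain ⟨aU, haU⟩ : ∃ aU : (ZMod u)ˣ, (aU : ZMod u) = ((γ 0 0 : ℤ) : ZMod u) :=
    ⟨Units.mkOfMulEqOne (((γ 0 0 : ℤ) : ZMod u)) (((γ 1 1 : ℤ) : ZMod u)) had_u, rfl⟩
  have hφd : φ ((γ 1 1 : ℤ) : ZMod v) ≠ 0 := fun h ↦ by
    have := congrArg φ had_v
    rw [map_mul, h, mul_zero, map_one] at this
    exact zero_ne_one this
  -- slash termwise and rewrite the index vectors
  rw [eisensteinTwoChar_eq_sum, SlashAction.sum_slash, Finset.smul_sum]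
  simp_rw [SlashAction.sum_slash, ModularForm.SL_smul_slash, eisensteinSeries_slash_apply,
    tcVec_vecMul_of_mem_gamma0 hγ, ← haU, ← hdU]
  -- reindex `c₁ ↦ c₁ a`
  refine Fintype.sum_equiv aU.mulRight _ _ fun c₁ ↦ ?_
  rw [Finset.smul_sum]
  -- reindex `d₀ ↦ d₀ d + v c₁ b`
  refine Fintype.sum_equiv (dU.mulRight.trans (Equiv.addRight (vMul c₁ * ((γ 0 1 : ℤ) : ZMod (u * v)))))
    _ _ fun d₀ ↦ ?_
  simp only [Equiv.trans_apply, Units.mulRight_apply, Equiv.coe_addRight, smul_smul]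
  congr 1
  -- the weights
  simp only [tcWeight, map_add, map_mul, castHom_vMul, zero_mul, add_zero, map_intCast, hdU, haU]
  rw [MulChar.inv_apply_eq_inv' φ (((γ 1 1 : ℤ) : ZMod v))]
  have hψ1 : ψ ((γ 1 1 : ℤ) : ZMod u) * ψ ((γ 0 0 : ℤ) : ZMod u) = 1 := by
    rw [← map_mul, mul_comm, had_u, map_one]
  have h2 : φ ((γ 1 1 : ℤ) : ZMod v) * (φ⁻¹ (ZMod.castHom (dvd_mul_left v u) (ZMod v) d₀) *
      (φ ((γ 1 1 : ℤ) : ZMod v))⁻¹) = φ⁻¹ (ZMod.castHom (dvd_mul_left v u) (ZMod v) d₀) := by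
    field_simp
  symm
  calc ψ ((γ 1 1 : ℤ) : ZMod u) * φ ((γ 1 1 : ℤ) : ZMod v) * (ψ c₁ * ψ ((γ 0 0 : ℤ) : ZMod u) *
        (φ⁻¹ (ZMod.castHom (dvd_mul_left v u) (ZMod v) d₀) * (φ ((γ 1 1 : ℤ) : ZMod v))⁻¹))
      = (ψ ((γ 1 1 : ℤ) : ZMod u) * ψ ((γ 0 0 : ℤ) : ZMod u)) * (ψ c₁ * (φ ((γ 1 1 : ℤ) : ZMod v) *
          (φ⁻¹ (ZMod.castHom (dvd_mul_left v u) (ZMod v) d₀) * (φ ((γ 1 1 : ℤ) : ZMod v))⁻¹))) := by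
        ring
    _ = ψ c₁ * φ⁻¹ (ZMod.castHom (dvd_mul_left v u) (ZMod v) d₀) := by rw [hψ1, h2, one_mul]

/-! ### `E_k^{ψ,φ}` as a modular form on `Γ₁(uv)` -/

/-- Holomorphy of `E_k^{ψ,φ}` (`k ≥ 3`). [folklore] -/
theorem mdifferentiable_eisensteinTwoChar (hk : 3 ≤ k) :
    MDifferentiable 𝓘(ℂ) 𝓘(ℂ) (eisensteinTwoChar k ψ φ) := by
  rw [eisensteinTwoChar_eq_sum]
  have h1 : ∀ (c₁ : ZMod u) (s : Finset (ZMod (u * v))), MDifferentiable 𝓘(ℂ) 𝓘(ℂ)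
      (∑ d₀ ∈ s, tcWeight ψ φ c₁ d₀ • eisensteinSeries (tcVec c₁ d₀) k) := by
    intro c₁ s
    induction s using Finset.induction_on with
    | empty => simp only [Finset.sum_empty]; exact mdifferentiable_const
    | insert d₀ s hd ih =>
      rw [Finset.sum_insert hd]
      exact ((eisensteinSeriesSIF_mdifferentiable hk _).const_smul _).add ih
  have h2 : ∀ s : Finset (ZMod u), MDifferentiable 𝓘(ℂ) 𝓘(ℂ)
      (∑ c₁ ∈ s, ∑ d₀ : ZMod (u * v), tcWeight ψ φ c₁ d₀ • eisensteinSeries (tcVec c₁ d₀) k) := by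
    intro s
    induction s using Finset.induction_on with
    | empty => simp only [Finset.sum_empty]; exact mdifferentiable_const
    | insert c₁ s hc ih =>
      rw [Finset.sum_insert hc]
      exact (h1 c₁ _).add ih
  exact h2 _

/-- Every `SL₂(ℤ)`-translate of `E_k^{ψ,φ}` is bounded at `i∞` (`k ≥ 3`). [folklore] -/
theorem isBoundedAtImInfty_eisensteinTwoChar_slash (hk : 3 ≤ k) (g : SL(2, ℤ)) :
    IsBoundedAtImInfty (eisensteinTwoChar k ψ φ ∣[k] g) := by
  rw [eisensteinTwoChar_eq_sum, SlashAction.sum_slash]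
  have h1 : ∀ (c₁ : ZMod u) (s : Finset (ZMod (u * v))), IsBoundedAtImInfty
      ((∑ d₀ ∈ s, tcWeight ψ φ c₁ d₀ • eisensteinSeries (tcVec c₁ d₀) k) ∣[k] g) := by
    intro c₁ s
    induction s using Finset.induction_on with
    | empty => simp only [Finset.sum_empty, SlashAction.zero_slash]; exact zero_form_isBoundedAtImInfty
    | insert d₀ s hd ih =>
      rw [Finset.sum_insert hd, SlashAction.add_slash, ModularForm.SL_smul_slash]
      exact ((isBoundedAtImInfty_eisensteinSeriesSIF _ hk g).const_smul_left _).add ih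
  have h2 : ∀ s : Finset (ZMod u), IsBoundedAtImInfty (∑ c₁ ∈ s,
      (∑ d₀ : ZMod (u * v), tcWeight ψ φ c₁ d₀ • eisensteinSeries (tcVec c₁ d₀) k) ∣[k] g) := by
    intro s
    induction s using Finset.induction_on with
    | empty => simp only [Finset.sum_empty]; exact zero_form_isBoundedAtImInfty
    | insert c₁ s hc ih =>
      rw [Finset.sum_insert hc]
      exact (h1 c₁ _).add ih
  exact h2 _

/-- `E_k^{ψ,φ}` is invariant under `Γ₁(uv)`. [folklore] -/
theorem eisensteinTwoChar_slash_of_mem_gamma1 {γ : SL(2, ℤ)} (hγ : γ ∈ Gamma1 (u * v)) :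
    eisensteinTwoChar k ψ φ ∣[k] γ = eisensteinTwoChar k ψ φ := by
  rw [Gamma1_mem] at hγ
  rw [eisensteinTwoChar_slash_of_mem_gamma0 ψ φ (Gamma0_mem.2 hγ.2.2)]
  have hu : ((γ 1 1 : ℤ) : ZMod u) = 1 := by
    have := congrArg (ZMod.castHom (dvd_mul_right u v) (ZMod u)) hγ.2.1
    rwa [map_intCast, map_one] at this
  have hv : ((γ 1 1 : ℤ) : ZMod v) = 1 := by
    have := congrArg (ZMod.castHom (dvd_mul_left v u) (ZMod v)) hγ.2.1
    rwa [map_intCast, map_one] at this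
  rw [hu, hv, map_one, map_one, one_mul, one_smul]

variable (k) in
/-- **`E_k^{ψ,φ}` as a modular form of weight `k ≥ 3` on `Γ₁(uv)`.**
[cite: DiamondShurman2005, §4.5–4.6 (Thm. 4.5.1, Thm. 4.6.2)] -/
def eisensteinTwoCharMF (hk : 3 ≤ k) : ModularForm (Gamma1 (u * v)) k where
  toFun := eisensteinTwoChar k ψ φ
  slash_action_eq' A hA := by
    obtain ⟨A, (hA : A ∈ Gamma1 (u * v)), rfl⟩ := hA
    exact eisensteinTwoChar_slash_of_mem_gamma1 ψ φ hA
  holo' := mdifferentiable_eisensteinTwoChar ψ φ hk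
  bdd_at_cusps' {c} hc := by
    rw [Subgroup.IsArithmetic.isCusp_iff_isCusp_SL2Z] at hc
    rw [OnePoint.isBoundedAt_iff_forall_SL2Z hc]
    intro γ _
    exact isBoundedAtImInfty_eisensteinTwoChar_slash ψ φ hk γ

/-- The function of `eisensteinTwoCharMF`. [folklore] -/
@[simp] theorem coe_eisensteinTwoCharMF (hk : 3 ≤ k) :
    (⇑(eisensteinTwoCharMF k ψ φ hk) : ℍ → ℂ) = eisensteinTwoChar k ψ φ := rfl

/-- Nebentypus law for the modular form `E_k^{ψ,φ}`. [cite: DiamondShurman2005, Thm. 4.6.2] -/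
theorem eisensteinTwoCharMF_slash_of_mem_gamma0 (hk : 3 ≤ k) {γ : SL(2, ℤ)}
    (hγ : γ ∈ Gamma0 (u * v)) :
    (⇑(eisensteinTwoCharMF k ψ φ hk) : ℍ → ℂ) ∣[k] γ =
      (ψ ((γ 1 1 : ℤ) : ZMod u) * φ ((γ 1 1 : ℤ) : ZMod v)) •
        (⇑(eisensteinTwoCharMF k ψ φ hk) : ℍ → ℂ) :=
  eisensteinTwoChar_slash_of_mem_gamma0 ψ φ hγ

/-! ### Constant terms at all cusps -/

variable (k) in
/-- The constant term of `E_k^{ψ,φ} ∣_k γ` at `i∞` as a finite sum of cusp values of the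
level-`Γ(uv)` series. [folklore] -/
def twoCharCuspSum (γ : SL(2, ℤ)) : ℂ :=
  ∑ c₁ : ZMod u, ∑ d₀ : ZMod (u * v),
    tcWeight ψ φ c₁ d₀ * eisCuspValue ((tcVec c₁ d₀ : Fin 2 → ZMod (u * v)) ᵥ* γ) k

/-- **`E_k^{ψ,φ} ∣_k γ → twoCharCuspSum γ` at `i∞`** for every `γ ∈ SL₂(ℤ)` (`k ≥ 3`).
[cite: DiamondShurman2005, §4.2 (Thm. 4.2.3)] -/
theorem tendsto_eisensteinTwoChar_slash_atImInfty (hk : 3 ≤ k) (γ : SL(2, ℤ)) :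
    Tendsto (eisensteinTwoChar k ψ φ ∣[k] γ) atImInfty (𝓝 (twoCharCuspSum k ψ φ γ)) := by
  rw [eisensteinTwoChar_eq_sum, SlashAction.sum_slash]
  simp_rw [SlashAction.sum_slash, ModularForm.SL_smul_slash, eisensteinSeries_slash_apply]
  have hfun : (∑ c₁ : ZMod u, ∑ d₀ : ZMod (u * v), tcWeight ψ φ c₁ d₀ •
      eisensteinSeries ((tcVec c₁ d₀ : Fin 2 → ZMod (u * v)) ᵥ* γ) k) =
        fun z ↦ ∑ c₁ : ZMod u, ∑ d₀ : ZMod (u * v), tcWeight ψ φ c₁ d₀ *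
          eisensteinSeries ((tcVec c₁ d₀ : Fin 2 → ZMod (u * v)) ᵥ* γ) k z := by
    funext z
    simp [Finset.sum_apply]
  rw [hfun]
  exact tendsto_finsetSum _ fun c₁ _ ↦ tendsto_finsetSum _ fun d₀ _ ↦
    (tendsto_eisensteinSeries_atImInfty hk _).const_mul _

/-- The constant term of the modular form `E_k^{ψ,φ}` slashed by any `γ ∈ SL₂(ℤ)`. [folklore] -/
theorem tendsto_eisensteinTwoCharMF_slash_atImInfty (hk : 3 ≤ k) (γ : SL(2, ℤ)) :
    Tendsto ((⇑(eisensteinTwoCharMF k ψ φ hk) : ℍ → ℂ) ∣[k] γ) atImInfty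
      (𝓝 (twoCharCuspSum k ψ φ γ)) :=
  tendsto_eisensteinTwoChar_slash_atImInfty ψ φ hk γ

omit [NeZero u] [NeZero v] in
/-- `(v c₁, d₀) γ = (v c₁ a + d₀ c, v c₁ b + d₀ d)` for any `γ = (a b; c d) ∈ SL₂(ℤ)`. [folklore] -/
theorem tcVec_vecMul (γ : SL(2, ℤ)) (c₁ : ZMod u) (d₀ : ZMod (u * v)) :
    (tcVec c₁ d₀ : Fin 2 → ZMod (u * v)) ᵥ* γ =
      ![vMul c₁ * ((γ 0 0 : ℤ) : ZMod (u * v)) + d₀ * ((γ 1 0 : ℤ) : ZMod (u * v)),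
        vMul c₁ * ((γ 0 1 : ℤ) : ZMod (u * v)) + d₀ * ((γ 1 1 : ℤ) : ZMod (u * v))] := by
  funext j
  fin_cases j <;> simp [tcVec, Matrix.vecMul, dotProduct, Fin.sum_univ_two]

omit [NeZero u] [NeZero v] in
/-- `a d - b c = 1` modulo `uv`. [folklore] -/
theorem det_cast (γ : SL(2, ℤ)) :
    ((γ 0 0 : ℤ) : ZMod (u * v)) * ((γ 1 1 : ℤ) : ZMod (u * v)) -
      ((γ 0 1 : ℤ) : ZMod (u * v)) * ((γ 1 0 : ℤ) : ZMod (u * v)) = 1 := by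
  have hdet := Matrix.SpecialLinearGroup.det_coe γ
  rw [Matrix.det_fin_two] at hdet
  have := congrArg ((↑) : ℤ → ZMod (u * v)) hdet
  push_cast at this
  exact this

omit [NeZero u] [NeZero v] in
/-- `(0, 1) = (v c₁, d₀) γ` iff `v c₁ = -c` and `d₀ = a`. [folklore] -/
theorem vec01_eq_tcVec_vecMul_iff (γ : SL(2, ℤ)) (c₁ : ZMod u) (d₀ : ZMod (u * v)) :
    ((↑) : ℤ → ZMod (u * v)) ∘ ![0, 1] = (tcVec c₁ d₀ : Fin 2 → ZMod (u * v)) ᵥ* γ ↔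
      vMul c₁ = -((γ 1 0 : ℤ) : ZMod (u * v)) ∧ d₀ = ((γ 0 0 : ℤ) : ZMod (u * v)) := by
  have hdet := det_cast (u := u) (v := v) γ
  rw [tcVec_vecMul]
  constructor
  · intro h
    have h0 := congr_fun h 0
    have h1 := congr_fun h 1
    simp only [Function.comp_apply, Matrix.cons_val_zero, Matrix.cons_val_one, Matrix.cons_val_fin_one,
      Int.cast_zero, Int.cast_one] at h0 h1
    constructor
    · linear_combination (-((γ 1 1 : ℤ) : ZMod (u * v))) * h0 + ((γ 1 0 : ℤ) : ZMod (u * v)) * h1 -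
        vMul c₁ * hdet
    · linear_combination ((γ 0 1 : ℤ) : ZMod (u * v)) * h0 - ((γ 0 0 : ℤ) : ZMod (u * v)) * h1 -
        d₀ * hdet
  · rintro ⟨h0, h1⟩
    funext j
    fin_cases j
    · simp [h0, h1]; ring
    · simp [h0, h1]; linear_combination -hdet

omit [NeZero u] [NeZero v] in
/-- `(0, -1) = (v c₁, d₀) γ` iff `v c₁ = c` and `d₀ = -a`. [folklore] -/
theorem vec0neg1_eq_tcVec_vecMul_iff (γ : SL(2, ℤ)) (c₁ : ZMod u) (d₀ : ZMod (u * v)) :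
    ((↑) : ℤ → ZMod (u * v)) ∘ ![0, -1] = (tcVec c₁ d₀ : Fin 2 → ZMod (u * v)) ᵥ* γ ↔
      vMul c₁ = ((γ 1 0 : ℤ) : ZMod (u * v)) ∧ d₀ = -((γ 0 0 : ℤ) : ZMod (u * v)) := by
  have hdet := det_cast (u := u) (v := v) γ
  rw [tcVec_vecMul]
  constructor
  · intro h
    have h0 := congr_fun h 0
    have h1 := congr_fun h 1
    simp only [Function.comp_apply, Matrix.cons_val_zero, Matrix.cons_val_one, Matrix.cons_val_fin_one,
      Int.cast_zero, Int.cast_one, Int.cast_neg] at h0 h1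
    constructor
    · linear_combination (-((γ 1 1 : ℤ) : ZMod (u * v))) * h0 + ((γ 1 0 : ℤ) : ZMod (u * v)) * h1 -
        vMul c₁ * hdet
    · linear_combination ((γ 0 1 : ℤ) : ZMod (u * v)) * h0 - ((γ 0 0 : ℤ) : ZMod (u * v)) * h1 -
        d₀ * hdet
  · rintro ⟨h0, h1⟩
    funext j
    fin_cases j
    · simp [h0, h1]; ring
    · simp [h0, h1]; linear_combination hdet

omit [NeZero u] [NeZero v] in
/-- The cusp value of `E_{k,(vc₁,d₀)γ}` in terms of the two linear conditions. [folklore] -/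
theorem eisCuspValue_tcVec_vecMul (γ : SL(2, ℤ)) (c₁ : ZMod u) (d₀ : ZMod (u * v)) :
    eisCuspValue ((tcVec c₁ d₀ : Fin 2 → ZMod (u * v)) ᵥ* γ) k =
      (if vMul c₁ = -((γ 1 0 : ℤ) : ZMod (u * v)) ∧ d₀ = ((γ 0 0 : ℤ) : ZMod (u * v)) then 1 else 0) +
        (if vMul c₁ = ((γ 1 0 : ℤ) : ZMod (u * v)) ∧ d₀ = -((γ 0 0 : ℤ) : ZMod (u * v))
          then (-1 : ℂ) ^ (-k) else 0) := by
  classical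
  simp only [eisCuspValue]
  rw [if_congr (vec01_eq_tcVec_vecMul_iff γ c₁ d₀) rfl rfl,
    if_congr (vec0neg1_eq_tcVec_vecMul_iff γ c₁ d₀) rfl rfl]

/-- A double sum against the indicator of `v c₁ = t₀ ∧ d₀ = t₁`. [folklore] -/
theorem sum_sum_mul_ite_and (t₀ t₁ : ZMod (u * v)) (r : ℂ) :
    ∑ c₁ : ZMod u, ∑ d₀ : ZMod (u * v), tcWeight ψ φ c₁ d₀ *
        (if vMul c₁ = t₀ ∧ d₀ = t₁ then r else 0) =
      ∑ c₁ : ZMod u, if vMul c₁ = t₀ then tcWeight ψ φ c₁ t₁ * r else 0 := by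
  classical
  refine Finset.sum_congr rfl fun c₁ _ ↦ ?_
  by_cases hc : vMul c₁ = t₀
  · simp only [hc, true_and, if_true, mul_ite, mul_zero]
    rw [Finset.sum_ite_eq' Finset.univ t₁, if_pos (Finset.mem_univ _)]
  · simp [hc]

/-- **Constant term of `E_k^{ψ,φ} ∣_k γ` when `v ∤ c`: zero.** [cite: DiamondShurman2005, §4.2, §4.5–4.6] -/
theorem twoCharCuspSum_of_not_dvd {γ : SL(2, ℤ)} (h : ¬ (v : ℤ) ∣ (γ 1 0 : ℤ)) :
    twoCharCuspSum k ψ φ γ = 0 := by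
  classical
  have hne : ∀ c₁ : ZMod u, vMul c₁ ≠ ((γ 1 0 : ℤ) : ZMod (u * v)) ∧
      vMul c₁ ≠ -((γ 1 0 : ℤ) : ZMod (u * v)) := by
    intro c₁
    have hcast : ∀ t : ℤ, vMul c₁ = (t : ZMod (u * v)) → (v : ℤ) ∣ t := fun t ht ↦ by
      have := congrArg (ZMod.castHom (dvd_mul_left v u) (ZMod v)) ht
      rw [castHom_vMul, map_intCast, eq_comm, ZMod.intCast_zmod_eq_zero_iff_dvd] at this
      exact this
    refine ⟨fun h1 ↦ h (hcast _ h1), fun h1 ↦ h ?_⟩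
    have := hcast (-(γ 1 0 : ℤ)) (by rw [h1, Int.cast_neg])
    exact (dvd_neg.mp this)
  unfold twoCharCuspSum
  simp_rw [eisCuspValue_tcVec_vecMul, mul_add, Finset.sum_add_distrib, sum_sum_mul_ite_and]
  rw [Finset.sum_eq_zero fun c₁ _ ↦ if_neg (hne c₁).2, Finset.sum_eq_zero fun c₁ _ ↦ if_neg (hne c₁).1,
    add_zero]

/-- **Constant term of `E_k^{ψ,φ} ∣_k γ` when `c = v c'`:**
`ψ(-c') φ̄(a) + (-1)^{-k} ψ(c') φ̄(-a)`. [cite: DiamondShurman2005, §4.2, §4.5–4.6] -/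
theorem twoCharCuspSum_of_eq_mul {γ : SL(2, ℤ)} (c' : ℤ) (h : (γ 1 0 : ℤ) = v * c') :
    twoCharCuspSum k ψ φ γ =
      ψ ((-c' : ℤ) : ZMod u) * φ⁻¹ ((γ 0 0 : ℤ) : ZMod v) +
        (-1 : ℂ) ^ (-k) * (ψ ((c' : ℤ) : ZMod u) * φ⁻¹ (-((γ 0 0 : ℤ) : ZMod v))) := by
  classical
  have hsol : ∀ (c₁ : ZMod u) (t : ℤ), vMul c₁ = (((v : ℤ) * t : ℤ) : ZMod (u * v)) ↔ c₁ = (t : ZMod u) :=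
    fun c₁ t ↦ ⟨fun h1 ↦ vMul_injective (h1.trans (vMul_intCast t).symm), fun h1 ↦ h1 ▸ vMul_intCast t⟩
  have hplus : ∀ c₁ : ZMod u, vMul c₁ = -((γ 1 0 : ℤ) : ZMod (u * v)) ↔ c₁ = ((-c' : ℤ) : ZMod u) := by
    intro c₁; rw [← hsol, h]; push_cast; ring_nf
  have hminus : ∀ c₁ : ZMod u, vMul c₁ = ((γ 1 0 : ℤ) : ZMod (u * v)) ↔ c₁ = ((c' : ℤ) : ZMod u) := by
    intro c₁; rw [← hsol, h]
  unfold twoCharCuspSum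
  simp_rw [eisCuspValue_tcVec_vecMul, mul_add, Finset.sum_add_distrib, sum_sum_mul_ite_and]
  simp_rw [if_congr (hplus _) rfl rfl, if_congr (hminus _) rfl rfl]
  rw [Finset.sum_ite_eq' Finset.univ, if_pos (Finset.mem_univ _),
    Finset.sum_ite_eq' Finset.univ, if_pos (Finset.mem_univ _)]
  simp only [tcWeight, map_intCast, map_neg, mul_one]
  ring

end TwoChar

end Literature.NumberTheory.EllipticCurves.ModularForms
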